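import Summits.HubbardSuperconductivity.HubbardSuperconductivity.Theorems.SoloBlindTwistAveraging
import Literature.MathematicalPhysics.QuantumLattice.FermionLiebRobinson
import Literature.MathematicalPhysics.QuantumLattice.HubbardOneParticleCost
import Literature.MathematicalPhysics.QuantumLattice.PairFieldYangCeiling
import HarnessLib

/-!
# Locality of the d-wave pair field: `‖[Δ, Δᴴ]‖ = O(L²)`

Obstruction report, Theorem 11 (book-keeping part; used by `SoloBlindPairTowerBound`).

The pair field `Δ_g = Σ_{(x,e)} (g(e)/√2) P(x,e)` is a sum of `≤ 5L²` two-site terms of norm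
`≤ 2`, each an EVEN element of the CAR algebra of its two sites; even elements with disjoint
supports commute (`commute_of_mem_carEvenSubalgebra`, Bratteli–Robinson II §5.2.2). Hence
commutators of `Δ_g` with sums of local terms are of the order of the volume:

* `norm_commutator_sum_le` — abstract: if `A = Σ_i a_i`, `B = Σ_j b_j` with `a_i`, `b_j` commuting
  unless `i ~ j`, `‖a_i‖ ≤ α`, `‖b_j‖ ≤ β_j` and at most `m` indices `i ~ j` for each `j`, then
  `‖[A,B]‖ ≤ 2 α m Σ_j β_j` (book-keeping of local terms, Hastings–Koma CMP 265 (2006) App. A);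
* `pairField_eq_sum_pairOp`, `pairOp_mem_carEvenSubalgebra`, `norm_pairOp_le`,
  `card_filter_pairIdx_le` (at most `10|W|` pair terms meet a set `W` of sites);
* `norm_commutator_pairField_conjTranspose_le` — `‖[Δ_g, Δ_gᴴ]‖ ≤ 800 L²` for `|g| ≤ 1`.

Tags: [folklore] (locality book-keeping); the constants are not optimised.
-/

namespace Summit.HubbardSuperconductivity.HubbardSuperconductivity.Theorems

open Matrix Finset Literature.MathematicalPhysics.QuantumLattice HubbardWave0 GaugeTwist
open Literature.Probability.LatticeModels (Torus.proj TorusSite)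
open scoped ComplexConjugate ComplexOrder Matrix.Norms.L2Operator

namespace PairTower

/-! ### Abstract locality book-keeping for commutators of sums of local terms -/

section AbstractNorm

variable {n : Type*} [Fintype n] [DecidableEq n]

/-- **Commutator of two sums of local terms.** If `a_i` (`i ∈ SI`) and `b_j` (`j ∈ SJ`) commute
unless `i ~ j`, `‖a_i‖ ≤ α`, `‖b_j‖ ≤ β_j`, and for each `j` at most `m` indices `i` have `i ~ j`,
then `‖(Σa)(Σb) - (Σb)(Σa)‖ ≤ 2 α m Σ_j β_j`. Hastings–Koma, CMP 265 (2006) 781, App. A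
(book-keeping of local terms); Bratteli–Robinson II §5.2.2. [folklore] -/
theorem norm_commutator_sum_le {I J : Type*} (SI : Finset I) (SJ : Finset J)
    (a : I → Matrix n n ℂ) (b : J → Matrix n n ℂ) (overl : I → J → Prop)
    [∀ i j, Decidable (overl i j)] {α : ℝ} {β : J → ℝ} {m : ℕ} (hα : 0 ≤ α)
    (hβ : ∀ j ∈ SJ, 0 ≤ β j)
    (hcomm : ∀ i ∈ SI, ∀ j ∈ SJ, ¬ overl i j → Commute (a i) (b j))
    (ha : ∀ i ∈ SI, ‖a i‖ ≤ α) (hb : ∀ j ∈ SJ, ‖b j‖ ≤ β j)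
    (hcount : ∀ j ∈ SJ, (SI.filter fun i => overl i j).card ≤ m) :
    ‖(∑ i ∈ SI, a i) * (∑ j ∈ SJ, b j) - (∑ j ∈ SJ, b j) * (∑ i ∈ SI, a i)‖ ≤
      2 * α * m * ∑ j ∈ SJ, β j := by
  have hexp : (∑ i ∈ SI, a i) * (∑ j ∈ SJ, b j) - (∑ j ∈ SJ, b j) * (∑ i ∈ SI, a i) =
      ∑ j ∈ SJ, ∑ i ∈ SI.filter (fun i => overl i j), (a i * b j - b j * a i) := by
    have h1 : (∑ i ∈ SI, a i) * (∑ j ∈ SJ, b j) = ∑ j ∈ SJ, ∑ i ∈ SI, a i * b j := by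
      rw [Finset.mul_sum]
      exact Finset.sum_congr rfl fun j _ => Finset.sum_mul _ _ _
    have h2 : (∑ j ∈ SJ, b j) * (∑ i ∈ SI, a i) = ∑ j ∈ SJ, ∑ i ∈ SI, b j * a i := by
      rw [Finset.sum_mul]
      exact Finset.sum_congr rfl fun j _ => Finset.mul_sum _ _ _
    rw [h1, h2, ← Finset.sum_sub_distrib]
    refine Finset.sum_congr rfl fun j hj => ?_
    rw [← Finset.sum_sub_distrib, ← Finset.sum_filter_add_sum_filter_not SI (fun i => overl i j),
      Finset.sum_eq_zero (s := SI.filter fun i => ¬ overl i j) (fun i hi => ?_), add_zero]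
    rw [Finset.mem_filter] at hi
    exact sub_eq_zero.2 (hcomm i hi.1 j hj hi.2).eq
  rw [hexp]
  calc ‖∑ j ∈ SJ, ∑ i ∈ SI.filter (fun i => overl i j), (a i * b j - b j * a i)‖
      ≤ ∑ j ∈ SJ, ∑ i ∈ SI.filter (fun i => overl i j), ‖a i * b j - b j * a i‖ :=
        (norm_sum_le _ _).trans (Finset.sum_le_sum fun j _ => norm_sum_le _ _)
    _ ≤ ∑ j ∈ SJ, ∑ _i ∈ SI.filter (fun i => overl i j), 2 * α * β j := by
        refine Finset.sum_le_sum fun j hj => Finset.sum_le_sum fun i hi => ?_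
        have hi' := (Finset.mem_filter.1 hi).1
        calc ‖a i * b j - b j * a i‖ ≤ ‖a i‖ * ‖b j‖ + ‖b j‖ * ‖a i‖ :=
              (norm_sub_le _ _).trans (add_le_add (norm_mul_le _ _) (norm_mul_le _ _))
          _ ≤ α * β j + β j * α :=
              add_le_add (mul_le_mul (ha i hi') (hb j hj) (norm_nonneg _) hα)
                (mul_le_mul (hb j hj) (ha i hi') (norm_nonneg _) (hβ j hj))
          _ = 2 * α * β j := by ring
    _ = ∑ j ∈ SJ, ((SI.filter fun i => overl i j).card : ℝ) * (2 * α * β j) := by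
        refine Finset.sum_congr rfl fun j _ => ?_
        rw [Finset.sum_const, nsmul_eq_mul]
    _ ≤ ∑ j ∈ SJ, (m : ℝ) * (2 * α * β j) := by
        refine Finset.sum_le_sum fun j hj => ?_
        have h0 : 0 ≤ 2 * α * β j := by have := hβ j hj; positivity
        exact mul_le_mul_of_nonneg_right (by exact_mod_cast hcount j hj) h0
    _ = 2 * α * m * ∑ j ∈ SJ, β j := by
        rw [Finset.mul_sum]
        exact Finset.sum_congr rfl fun j _ => by ring

/-- `|re ⟨ψ, M ψ⟩| ≤ ‖M‖ ‖ψ‖²` (Cauchy–Schwarz with the operator norm). [folklore] -/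
theorem abs_re_expect_le_norm_mul (M : Matrix n n ℂ) (ψ : n → ℂ) :
    |(star ψ ⬝ᵥ M *ᵥ ψ).re| ≤ ‖M‖ * ‖(WithLp.toLp 2 ψ : EuclideanSpace ℂ n)‖ ^ 2 := by
  calc |(star ψ ⬝ᵥ M *ᵥ ψ).re| ≤ ‖star ψ ⬝ᵥ M *ᵥ ψ‖ := Complex.abs_re_le_norm _
    _ ≤ ‖(WithLp.toLp 2 ψ : EuclideanSpace ℂ n)‖ *
          (‖M‖ * ‖(WithLp.toLp 2 ψ : EuclideanSpace ℂ n)‖) :=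
        ThermodynamicLimit.norm_star_dotProduct_mulVec_le M ψ ψ
    _ = ‖M‖ * ‖(WithLp.toLp 2 ψ : EuclideanSpace ℂ n)‖ ^ 2 := by ring

omit [DecidableEq n] in
/-- `‖Mᴴψ‖² - ‖Mψ‖² = re ⟨ψ, [M, Mᴴ] ψ⟩`. [folklore] -/
theorem re_self_conjTranspose_sub (M : Matrix n n ℂ) (ψ : n → ℂ) :
    (star (Mᴴ *ᵥ ψ) ⬝ᵥ (Mᴴ *ᵥ ψ)).re - (star (M *ᵥ ψ) ⬝ᵥ (M *ᵥ ψ)).re =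
      (star ψ ⬝ᵥ (M * Mᴴ - Mᴴ * M) *ᵥ ψ).re := by
  have h1 : star (Mᴴ *ᵥ ψ) ⬝ᵥ (Mᴴ *ᵥ ψ) = star ψ ⬝ᵥ (M * Mᴴ) *ᵥ ψ := by
    rw [star_mulVec, conjTranspose_conjTranspose, ← dotProduct_mulVec, mulVec_mulVec]
  have h2 : star (M *ᵥ ψ) ⬝ᵥ (M *ᵥ ψ) = star ψ ⬝ᵥ (Mᴴ * M) *ᵥ ψ := by
    rw [star_mulVec, ← dotProduct_mulVec, mulVec_mulVec]
  rw [h1, h2, sub_mulVec, dotProduct_sub, Complex.sub_re]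

end AbstractNorm

/-! ### Local structure of the pair field on the torus -/

section Torus

-- see `SoloBlindTwistAveraging`: synthesised vs landed `DecidableEq` instances on `Lex`
attribute [-instance] instDecidableEqLex

variable {L : ℕ} [NeZero L]

/-- The index set of the pair terms: sites `x` and steps `e ∈ {0} ∪ unitSteps`. [folklore] -/
noncomputable def pairIdx (L : ℕ) [NeZero L] : Finset (TorusSite 2 L × (Fin 2 → ℤ)) :=
  Finset.univ ×ˢ insert 0 unitSteps

/-- The two sites `{x, x+e}` carrying `P(x,e)`. [folklore] -/
noncomputable def pairSupp (p : TorusSite 2 L × (Fin 2 → ℤ)) : Finset (FermionTorus 2 L) :=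
  {FermionTorus.ofTorusSite p.1, FermionTorus.ofTorusSite (p.1 + Torus.proj L p.2)}

/-- The weighted pair term `(g(e)/√2) P(x,e)`. [folklore] -/
noncomputable def pairOp (g : (Fin 2 → ℤ) → ℝ) (p : TorusSite 2 L × (Fin 2 → ℤ)) :
    Matrix (Finset (Orb (FermionTorus 2 L))) (Finset (Orb (FermionTorus 2 L))) ℂ :=
  ((g p.2 / Real.sqrt 2 : ℝ) : ℂ) • pairTerm p.1 p.2

/-- `|{0} ∪ unitSteps| ≤ 5`. [folklore] -/
theorem card_insert_zero_unitSteps_le : (insert (0 : Fin 2 → ℤ) unitSteps).card ≤ 5 :=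
  (Finset.card_insert_le _ _).trans (by rw [PairFieldYang.card_unitSteps_eq_four])

/-- `Δ_g = Σ_{(x,e)} (g(e)/√2) P(x,e)`. Scalapino, Phys. Rep. 250 (1995) 329, §2. [folklore] -/
theorem pairField_eq_sum_pairOp (g : (Fin 2 → ℤ) → ℝ) :
    pairField g L = ∑ p ∈ pairIdx L, pairOp g p := by
  rw [pairField, pairIdx, Finset.sum_product]
  exact Finset.sum_congr rfl fun x _ => localPair_eq_sum_pairTerm g x

/-- `Δ_gᴴ = Σ_{(x,e)} ((g(e)/√2) P(x,e))ᴴ`. [folklore] -/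
theorem pairField_conjTranspose_eq_sum (g : (Fin 2 → ℤ) → ℝ) :
    (pairField g L)ᴴ = ∑ p ∈ pairIdx L, (pairOp g p)ᴴ := by
  rw [pairField_eq_sum_pairOp, conjTranspose_sum]

/-- `|pairIdx| ≤ 5 L²`. [folklore] -/
theorem card_pairIdx_le : ((pairIdx L).card : ℝ) ≤ 5 * (L : ℝ) ^ 2 := by
  have h : (pairIdx L).card ≤ 5 * L ^ 2 := by
    rw [pairIdx, Finset.card_product, Finset.card_univ, Fintype.card_pi]
    simp only [ZMod.card, Finset.prod_const, Finset.card_univ, Fintype.card_fin]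
    have h5 := card_insert_zero_unitSteps_le
    calc L ^ 2 * (insert (0 : Fin 2 → ℤ) unitSteps).card ≤ L ^ 2 * 5 :=
          Nat.mul_le_mul_left _ h5
      _ = 5 * L ^ 2 := by ring
  exact_mod_cast h

/-- `|pairSupp p| ≤ 2`. [folklore] -/
theorem card_pairSupp_le (p : TorusSite 2 L × (Fin 2 → ℤ)) : (pairSupp p).card ≤ 2 :=
  Finset.card_le_two

/-- `‖P(x,e)‖ ≤ 2`. Bratteli–Robinson II §5.2.2 (`‖c‖ ≤ 1`). [folklore] -/
theorem norm_pairTerm_le (x : TorusSite 2 L) (e : Fin 2 → ℤ) : ‖pairTerm x e‖ ≤ 2 := by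
  have h : ∀ i j : Orb (FermionTorus 2 L),
      ‖(annihilation i * annihilation j :
        Matrix (Finset (Orb (FermionTorus 2 L))) (Finset (Orb (FermionTorus 2 L))) ℂ)‖ ≤ 1 :=
    fun i j => (norm_mul_le _ _).trans
      (mul_le_one₀ (norm_annihilation_le_one _) (norm_nonneg _) (norm_annihilation_le_one _))
  unfold pairTerm
  calc _ ≤ ‖(annihilation (orb (FermionTorus.ofTorusSite x) 0) *
            annihilation (orb (FermionTorus.ofTorusSite (x + Torus.proj L e)) 1) :
            Matrix (Finset (Orb (FermionTorus 2 L))) (Finset (Orb (FermionTorus 2 L))) ℂ)‖ +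
          ‖(annihilation (orb (FermionTorus.ofTorusSite x) 1) *
            annihilation (orb (FermionTorus.ofTorusSite (x + Torus.proj L e)) 0) :
            Matrix (Finset (Orb (FermionTorus 2 L))) (Finset (Orb (FermionTorus 2 L))) ℂ)‖ :=
        norm_sub_le _ _
    _ ≤ 1 + 1 := add_le_add (h _ _) (h _ _)
    _ = 2 := by norm_num

/-- `‖(g(e)/√2) P(x,e)‖ ≤ 2` for `|g| ≤ 1`. [folklore] -/
theorem norm_pairOp_le (g : (Fin 2 → ℤ) → ℝ) (hg : ∀ e, |g e| ≤ 1)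
    (p : TorusSite 2 L × (Fin 2 → ℤ)) : ‖pairOp g p‖ ≤ 2 := by
  unfold pairOp
  rw [norm_smul, Complex.norm_real, Real.norm_eq_abs, abs_div,
    abs_of_pos (Real.sqrt_pos.2 (by norm_num : (0 : ℝ) < 2))]
  have h1 : |g p.2| / Real.sqrt 2 ≤ 1 :=
    (div_le_self (abs_nonneg _) (Real.one_le_sqrt.2 (by norm_num))).trans (hg p.2)
  calc |g p.2| / Real.sqrt 2 * ‖pairTerm p.1 p.2‖ ≤ 1 * 2 :=
        mul_le_mul h1 (norm_pairTerm_le _ _) (norm_nonneg _) zero_le_one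
    _ = 2 := by norm_num

/-- `‖((g(e)/√2) P(x,e))ᴴ‖ ≤ 2` for `|g| ≤ 1`. [folklore] -/
theorem norm_pairOp_conjTranspose_le (g : (Fin 2 → ℤ) → ℝ) (hg : ∀ e, |g e| ≤ 1)
    (p : TorusSite 2 L × (Fin 2 → ℤ)) : ‖(pairOp g p)ᴴ‖ ≤ 2 := by
  rw [Matrix.l2_opNorm_conjTranspose]
  exact norm_pairOp_le g hg p

/-- `P(x,e)` is an even element of the CAR algebra of its two sites. Bratteli–Robinson II
§5.2.2. [folklore] -/
theorem pairTerm_mem_carEvenSubalgebra (p : TorusSite 2 L × (Fin 2 → ℤ)) :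
    pairTerm p.1 p.2 ∈ carEvenSubalgebra (orbSet (pairSupp p)) := by
  have hX : FermionTorus.ofTorusSite p.1 ∈ pairSupp p := Finset.mem_insert_self _ _
  have hY : FermionTorus.ofTorusSite (p.1 + Torus.proj L p.2) ∈ pairSupp p :=
    Finset.mem_insert_of_mem (Finset.mem_singleton_self _)
  unfold pairTerm
  exact Subalgebra.sub_mem _
    (Algebra.subset_adjoin ⟨(orb (FermionTorus.ofTorusSite p.1) 0, false),
      (orb (FermionTorus.ofTorusSite (p.1 + Torus.proj L p.2)) 1, false),
      orb_mem_orbSet hX 0, orb_mem_orbSet hY 1, rfl⟩)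
    (Algebra.subset_adjoin ⟨(orb (FermionTorus.ofTorusSite p.1) 1, false),
      (orb (FermionTorus.ofTorusSite (p.1 + Torus.proj L p.2)) 0, false),
      orb_mem_orbSet hX 1, orb_mem_orbSet hY 0, rfl⟩)

/-- `P(x,e)ᴴ` is an even element of the CAR algebra of its two sites. Bratteli–Robinson II
§5.2.2. [folklore] -/
theorem pairTerm_conjTranspose_mem_carEvenSubalgebra (p : TorusSite 2 L × (Fin 2 → ℤ)) :
    (pairTerm p.1 p.2)ᴴ ∈ carEvenSubalgebra (orbSet (pairSupp p)) := by
  have hX : FermionTorus.ofTorusSite p.1 ∈ pairSupp p := Finset.mem_insert_self _ _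
  have hY : FermionTorus.ofTorusSite (p.1 + Torus.proj L p.2) ∈ pairSupp p :=
    Finset.mem_insert_of_mem (Finset.mem_singleton_self _)
  unfold pairTerm
  rw [conjTranspose_sub, conjTranspose_mul, conjTranspose_mul, annihilation_conjTranspose,
    annihilation_conjTranspose, annihilation_conjTranspose, annihilation_conjTranspose]
  exact Subalgebra.sub_mem _
    (Algebra.subset_adjoin ⟨(orb (FermionTorus.ofTorusSite (p.1 + Torus.proj L p.2)) 1, true),
      (orb (FermionTorus.ofTorusSite p.1) 0, true),
      orb_mem_orbSet hY 1, orb_mem_orbSet hX 0, rfl⟩)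
    (Algebra.subset_adjoin ⟨(orb (FermionTorus.ofTorusSite (p.1 + Torus.proj L p.2)) 0, true),
      (orb (FermionTorus.ofTorusSite p.1) 1, true),
      orb_mem_orbSet hY 0, orb_mem_orbSet hX 1, rfl⟩)

/-- `(g/√2) P(x,e)` is even-local on its two sites. [folklore] -/
theorem pairOp_mem_carEvenSubalgebra (g : (Fin 2 → ℤ) → ℝ) (p : TorusSite 2 L × (Fin 2 → ℤ)) :
    pairOp g p ∈ carEvenSubalgebra (orbSet (pairSupp p)) :=
  Subalgebra.smul_mem _ (pairTerm_mem_carEvenSubalgebra p) _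

/-- `((g/√2) P(x,e))ᴴ` is even-local on its two sites. [folklore] -/
theorem pairOp_conjTranspose_mem_carEvenSubalgebra (g : (Fin 2 → ℤ) → ℝ)
    (p : TorusSite 2 L × (Fin 2 → ℤ)) :
    (pairOp g p)ᴴ ∈ carEvenSubalgebra (orbSet (pairSupp p)) := by
  unfold pairOp
  rw [conjTranspose_smul]
  exact Subalgebra.smul_mem _ (pairTerm_conjTranspose_mem_carEvenSubalgebra p) _

omit [NeZero L] in
/-- `orbSet` is monotone. [folklore] -/
theorem orbSet_mono {X Y : Finset (FermionTorus 2 L)} (h : X ⊆ Y) : orbSet X ⊆ orbSet Y := by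
  intro k hk
  rw [mem_orbSet] at hk ⊢
  exact h hk

/-- **Counting the pair terms near a set of sites**: at most `10 |W|` pairs `(x,e)` have a site in
`W` (`x = w` or `x = w - e`, five steps). [folklore] -/
theorem card_filter_pairIdx_le (W : Finset (FermionTorus 2 L)) :
    ((pairIdx L).filter fun p => ¬ Disjoint (pairSupp p) W).card ≤ 10 * W.card := by
  have hsub : ((pairIdx L).filter fun p => ¬ Disjoint (pairSupp p) W) ⊆
      W.biUnion (fun w => (insert (0 : Fin 2 → ℤ) unitSteps).biUnion fun e =>
        {(FermionTorus.toTorusSite w, e), (FermionTorus.toTorusSite w - Torus.proj L e, e)}) := by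
    intro p hp
    rw [Finset.mem_filter] at hp
    obtain ⟨hp, hdis⟩ := hp
    have he : p.2 ∈ insert (0 : Fin 2 → ℤ) unitSteps := (Finset.mem_product.1 hp).2
    rw [Finset.not_disjoint_iff] at hdis
    obtain ⟨w, hw1, hw2⟩ := hdis
    rw [Finset.mem_biUnion]
    refine ⟨w, hw2, ?_⟩
    rw [Finset.mem_biUnion]
    refine ⟨p.2, he, ?_⟩
    rw [Finset.mem_insert, Finset.mem_singleton]
    simp only [pairSupp, Finset.mem_insert, Finset.mem_singleton] at hw1
    rcases hw1 with h | h
    · left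
      rw [h, FermionTorus.toTorusSite_ofTorusSite]
    · right
      rw [h, FermionTorus.toTorusSite_ofTorusSite, add_sub_cancel_right]
  refine (Finset.card_le_card hsub).trans ((Finset.card_biUnion_le).trans ?_)
  have h5 := card_insert_zero_unitSteps_le
  calc ∑ w ∈ W, ((insert (0 : Fin 2 → ℤ) unitSteps).biUnion fun e =>
          {(FermionTorus.toTorusSite w, e), (FermionTorus.toTorusSite w - Torus.proj L e, e)}).card
      ≤ ∑ _w ∈ W, 10 := by
        refine Finset.sum_le_sum fun w _ => (Finset.card_biUnion_le).trans ?_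
        calc ∑ e ∈ insert (0 : Fin 2 → ℤ) unitSteps,
              ({(FermionTorus.toTorusSite w, e), (FermionTorus.toTorusSite w - Torus.proj L e, e)} :
                Finset (TorusSite 2 L × (Fin 2 → ℤ))).card
            ≤ ∑ _e ∈ insert (0 : Fin 2 → ℤ) unitSteps, 2 :=
              Finset.sum_le_sum fun e _ => Finset.card_le_two
          _ ≤ 10 := by rw [Finset.sum_const, smul_eq_mul]; omega
    _ = 10 * W.card := by rw [Finset.sum_const, smul_eq_mul, mul_comm]

/-- **`‖[Δ_g, Δ_gᴴ]‖ ≤ 800 L²`** for `|g| ≤ 1`: the commutator of the pair field with its adjoint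
is of the order of the volume, not its square (pairs commute unless they share a site).
Bratteli–Robinson II §5.2.2; Scalapino, Phys. Rep. 250 (1995) 329, §2. [this work] -/
theorem norm_commutator_pairField_conjTranspose_le (g : (Fin 2 → ℤ) → ℝ) (hg : ∀ e, |g e| ≤ 1) :
    ‖pairField g L * (pairField g L)ᴴ - (pairField g L)ᴴ * pairField g L‖ ≤ 800 * (L : ℝ) ^ 2 := by
  rw [pairField_conjTranspose_eq_sum, pairField_eq_sum_pairOp]
  have h := norm_commutator_sum_le (pairIdx L) (pairIdx L) (pairOp g) (fun q => (pairOp g q)ᴴ)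
    (fun p q => ¬ Disjoint (pairSupp p) (pairSupp q)) (α := 2) (β := fun _ => 2) (m := 20)
    (by norm_num) (fun _ _ => by norm_num)
    (fun p _ q _ hpq => commute_of_mem_carEvenSubalgebra (pairOp_mem_carEvenSubalgebra g p)
      (carEvenSubalgebra_le_carSubalgebra _ (pairOp_conjTranspose_mem_carEvenSubalgebra g q))
      (disjoint_orbSet (not_not.1 hpq)))
    (fun p _ => norm_pairOp_le g hg p) (fun q _ => norm_pairOp_conjTranspose_le g hg q)
    (fun q _ => (card_filter_pairIdx_le (pairSupp q)).trans
      (by linarith [card_pairSupp_le (L := L) q]))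
  refine h.trans ?_
  rw [Finset.sum_const, nsmul_eq_mul]
  have hc := card_pairIdx_le (L := L)
  push_cast
  nlinarith [hc]

end Torus

end PairTower

end Summit.HubbardSuperconductivity.HubbardSuperconductivity.Theorems
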